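/-
Copyright (c) 2026 the pub-hodgecm-mathlib formalisation cell (harness21).  Prover seat hodgecm-mathlib-K2Liu-p24 (g0), Track B «K2-LIT» ∕ hLiu418
#184♮, Road I v3, unit U5 «THE CLOSE», letter (c) «THE COEFFICIENT FUNCTIONALS AS LINEAR MAPS ON A CLASS OF CONTINUOUS FORMS» (desk K2Liu-p02 (g8)
2026-09-04T16:44:15Z: U5-C TOP ED. 2∕3 pin `coeff := cf` on the class `↥P`).  THEOREMS ONLY.
-/
import Summits.HodgeConjecture.HodgeConjecture.Theorems.K2LiuFourierCoeffContinuedEuler     -- ★ `fourierCoeffDelta_smul_fun`, `fourierCoeffDelta_const_mul` (+ ★ Φ1 defs ∕ characters)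
import Mathlib.MeasureTheory.Function.L1Space.Integrable
import HarnessLib

/-!
# K2_Liu road (hLiu418 = stmt-HodgeConjecture-24832), U5 letter (c): THE UNIPOTENT FOURIER COEFFICIENTS `φ ↦ φ_S(h)` ARE `ℂ`-LINEAR ON EVERY CLASS OF
# CONTINUOUS FORMS — `cf S : ↥P →ₗ[ℂ] (H(𝔸) → ℂ)` with `cf S y h = fourierCoeffDelta νN β S y h`

Cell `pub/hodgecm-mathlib` (D-0151), Track B, build stream 29; helper lane, count-neutral.  ★ U2 `K2LiuRankOneCoefficientComparison.rankOneRigidity` quantifies LINEAR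
coefficient functionals `coeff β : N →ₗ[ℂ] M`; the tree's unipotent Fourier coefficient ★ Φ1 `K2LiuSiegelUnipotentFourierDefs.fourierCoeffDelta νN β S φ h =
(∫ β)⁻¹ • ∫_{N_Δ(𝔸)} β(u) • (conj ψ_S(u) · φ(u h)) dνN(u)` is an INTEGRAL (Bochner junk `0` off integrability), hence linear in `φ` only where the integrand is
integrable.  The U5-C TOP (K2Liu-p02 (g8), ★ ED. 1 p861854 ∕ ED. 2 p861964 ∕ 📤 ED. 3 p862104) therefore pins `coeff := cf` on a CLASS `↥P` of continuous forms.
THIS FILE supplies `cf`, for the carrier of #41 ED. 9 (`νN` a measure on `N_Δ(𝔸)` FINITE ON COMPACTS — e.g. a Haar measure — and a measurable weight `β` with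
`β ≤ 𝟙_K` for a compact `K`, exactly what ★ `K2LiuUnipotentCoveringWeight.exists_isCoveringWeight_unipDeltaRat_lintegral_ne_top` delivers):

* §1 `integrable_fourierCoeffDelta_integrand` — for CONTINUOUS `φ` the integrand `u ↦ β(u) • (conj ψ_S(u) · φ(u h))` is `νN`-integrable: it is a.e.-strongly
  measurable (★ `continuous_unipDeltaChar_coe`, continuity of `u ↦ φ(u h)`, measurability of `β`) and dominated by `C · 𝟙_K` with `C = sup_K ‖φ(· h)‖`
  (Mathlib `IsCompact.exists_bound_of_continuousOn`, `|ψ_S| = 1` ★ `norm_conj_unipDeltaChar_mul`), `νN K < ∞`.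
* §2 `fourierCoeffDelta_add_of_continuous` — `(φ + φ′)_S(h) = φ_S(h) + φ′_S(h)` for continuous `φ, φ′` (`integral_add`); homogeneity is ★
  `fourierCoeffDelta_smul_fun` (unconditional).
* §3 **`exists_linear_fourierCoeffDelta`** — THE HEAD the TOP consumes: for every submodule `P ≤ (H(𝔸) → ℂ)` of CONTINUOUS functions there is
  `cf : Matrix (Fin n) (Fin n) L → ↥P →ₗ[ℂ] (H(𝔸) → ℂ)` with `cf S y h = fourierCoeffDelta νN β S y h` for all `S`, `y`, `h` (`LinearMap.mk` over `funext`; no `def`).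

No definition, no instance, no notation, no named-fact hypothesis, no `sorry`; axioms ⊆ {propext, Classical.choice, Quot.sound}.  HONEST LABEL: HC_CM is proved only
modulo the 7 printed citations (2 remaining named inputs: hLiu418 = stmt-HodgeConjecture-24832, h413 = stmt-HodgeConjecture-24833) until rung 0 closes; this file is a
`--supports stmt-HodgeConjecture-24832` helper and moves no counter.

References: [MoeglinWaldspurger1995] C. Mœglin, J.-L. Waldspurger, Cambridge Tracts 113 (1995) I.2.6 (Fourier coefficients along a unipotent radical); [Tan1999]
V. Tan, Canad. J. Math. 51 (1999) §3; [Shimura1997] G. Shimura, Euler Products and Eisenstein Series, §18.1 (18.4); [KudlaRallis1994] Ann. of Math. 140 (1994) §1–§2.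
-/

set_option autoImplicit false
set_option linter.dupNamespace false

noncomputable section

open scoped Matrix ENNReal NNReal ComplexConjugate
open NumberField IsDedekindDomain MeasureTheory Set
open Literature.NumberTheory.Automorphic Literature.NumberTheory.Automorphic.UnitaryGroup
open Literature.NumberTheory.GelbartRogawski1991 Literature.NumberTheory.GelbartRogawski1991.GRConstruction
open Literature.NumberTheory.K2Lit.SiegelDoubled

namespace Summit.HodgeConjecture.HodgeConjecture.Cruxes.HLiu418.K2LiuFourierCoeffDeltaLinear

open K2LiuSiegelUnipotentFourierDefs K2LiuSiegelUnipotentCharacters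
open K2LiuFourierCoeffContinuedEuler (fourierCoeffDelta_smul_fun)

variable (L : Type) [Field L] [NumberField L] [IsCMField L]
variable {N M n : ℕ} (e : Fin N × Fin M ≃ Fin n)
  (dV : Fin N → L) (hdV : ∀ i, IsCMField.complexConj L (dV i) = dV i)
  (dW : Fin M → L) (hdW : ∀ i, IsCMField.complexConj L (dW i) = dW i)
variable [MeasurableSpace (unipDelta L e dV hdV dW hdW)] [BorelSpace (unipDelta L e dV hdV dW hdW)]
  (νN : Measure (unipDelta L e dV hdV dW hdW)) [IsFiniteMeasureOnCompacts νN]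
  {β : unipDelta L e dV hdV dW hdW → ℝ≥0∞} (hβm : Measurable β)
  {K : Set (unipDelta L e dV hdV dW hdW)} (hK : IsCompact K) (hβK : ∀ u, β u ≤ K.indicator 1 u)

/-! ## §1 Integrability of the Fourier integrand for a continuous form -/

include hβm hK hβK in
/-- **The integrand of `φ_S(h)` is integrable for CONTINUOUS `φ`**: `u ↦ β(u) • (conj ψ_S(u) · φ(u h))` is a.e.-strongly measurable and dominated by `C · 𝟙_K`
(`β ≤ 𝟙_K`, `|ψ_S| = 1`, `‖φ(· h)‖ ≤ C` on the compact `K`), and `νN K < ∞`. [cite: MoeglinWaldspurger1995, I.2.6] [cite: Tan1999, §3] -/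
theorem integrable_fourierCoeffDelta_integrand (S : Matrix (Fin n) (Fin n) L) {φ : HA L e dV hdV dW hdW → ℂ} (hφ : Continuous φ)
    (h : HA L e dV hdV dW hdW) :
    Integrable (fun u : unipDelta L e dV hdV dW hdW =>
      (β u).toReal • (conj (unipDeltaChar L e dV hdV dW hdW S (u : HA L e dV hdV dW hdW) : ℂ) * φ ((u : HA L e dV hdV dW hdW) * h))) νN := by
  -- the slice `u ↦ φ(u h)` is continuous on `N_Δ(𝔸)`, hence bounded on `K`
  have hslice : Continuous fun u : unipDelta L e dV hdV dW hdW => φ ((u : HA L e dV hdV dW hdW) * h) :=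
    hφ.comp (continuous_subtype_val.mul continuous_const)
  obtain ⟨C, hC⟩ := hK.exists_bound_of_continuousOn hslice.continuousOn
  -- measurability
  have hmeas : AEStronglyMeasurable (fun u : unipDelta L e dV hdV dW hdW =>
      (β u).toReal • (conj (unipDeltaChar L e dV hdV dW hdW S (u : HA L e dV hdV dW hdW) : ℂ) * φ ((u : HA L e dV hdV dW hdW) * h))) νN :=
    (hβm.ennreal_toReal.aestronglyMeasurable).smul
      (((Complex.continuous_conj.comp (continuous_unipDeltaChar_coe L e dV hdV dW hdW S)).mul hslice).aestronglyMeasurable)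
  -- domination by `(max C 0) · 𝟙_K`, integrable since `νN K < ∞`
  have hdom : Integrable (K.indicator fun _ => (max C 0 : ℝ)) νN :=
    (integrable_indicator_iff hK.isClosed.measurableSet).2 (integrableOn_const hK.measure_lt_top.ne)
  refine hdom.mono' hmeas (Filter.Eventually.of_forall fun u => ?_)
  by_cases hu : u ∈ K
  · have hβ1 : (β u).toReal ≤ 1 := by
      have h1 : β u ≤ 1 := (hβK u).trans (by rw [Set.indicator_of_mem hu]; exact le_rfl)
      simpa using ENNReal.toReal_mono ENNReal.one_ne_top h1
    rw [Set.indicator_of_mem hu, norm_smul, Real.norm_of_nonneg ENNReal.toReal_nonneg, norm_conj_unipDeltaChar_mul]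
    exact (mul_le_mul hβ1 (hC u hu) (norm_nonneg _) zero_le_one).trans (by rw [one_mul]; exact le_max_left _ _)
  · have hβ0 : β u = 0 := le_antisymm ((hβK u).trans (by rw [Set.indicator_of_notMem hu])) bot_le
    rw [Set.indicator_of_notMem hu, hβ0, ENNReal.toReal_zero, zero_smul, norm_zero]

/-! ## §2 Additivity on continuous forms -/

include hβm hK hβK in
/-- **`(φ + φ′)_S(h) = φ_S(h) + φ′_S(h)`** for continuous `φ, φ′` (`integral_add` on the two integrable integrands of §1).
[cite: MoeglinWaldspurger1995, I.2.6] [cite: Tan1999, §3] -/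
theorem fourierCoeffDelta_add_of_continuous (S : Matrix (Fin n) (Fin n) L) {φ φ' : HA L e dV hdV dW hdW → ℂ} (hφ : Continuous φ) (hφ' : Continuous φ')
    (h : HA L e dV hdV dW hdW) :
    fourierCoeffDelta L e dV hdV dW hdW νN β S (φ + φ') h =
      fourierCoeffDelta L e dV hdV dW hdW νN β S φ h + fourierCoeffDelta L e dV hdV dW hdW νN β S φ' h := by
  rw [fourierCoeffDelta_def, fourierCoeffDelta_def, fourierCoeffDelta_def, ← smul_add,
    ← integral_add (integrable_fourierCoeffDelta_integrand L e dV hdV dW hdW νN hβm hK hβK S hφ h)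
      (integrable_fourierCoeffDelta_integrand L e dV hdV dW hdW νN hβm hK hβK S hφ' h)]
  congr 1
  refine integral_congr_ae (Filter.Eventually.of_forall fun u => ?_)
  simp only [Pi.add_apply, mul_add, smul_add]

/-! ## §3 The head: coefficient functionals as linear maps on a class of continuous forms -/

include hβm hK hβK in
/-- **(c) THE COEFFICIENT FUNCTIONALS AS LINEAR MAPS ON A CLASS OF CONTINUOUS FORMS.**  For every submodule `P` of `H(𝔸) → ℂ` consisting of CONTINUOUS functions
there is `cf : Matrix (Fin n) (Fin n) L → ↥P →ₗ[ℂ] (H(𝔸) → ℂ)` with `cf S y h = fourierCoeffDelta νN β S y h` — the `coeff` of ★ U2 `rankOneRigidity` pinned on `↥P`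
(U5-C TOP ED. 2∕3).  Additivity §2, homogeneity ★ `fourierCoeffDelta_smul_fun`. [cite: MoeglinWaldspurger1995, I.2.6] [cite: KudlaRallis1994, §1] [cite: Tan1999, §3] -/
theorem exists_linear_fourierCoeffDelta (P : Submodule ℂ (HA L e dV hdV dW hdW → ℂ)) (hPc : ∀ F ∈ P, Continuous F) :
    ∃ cf : Matrix (Fin n) (Fin n) L → ↥P →ₗ[ℂ] (HA L e dV hdV dW hdW → ℂ),
      ∀ (S : Matrix (Fin n) (Fin n) L) (y : ↥P) (h : HA L e dV hdV dW hdW),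
        cf S y h = fourierCoeffDelta L e dV hdV dW hdW νN β S (y : HA L e dV hdV dW hdW → ℂ) h :=
  ⟨fun S =>
    { toFun := fun y h => fourierCoeffDelta L e dV hdV dW hdW νN β S (y : HA L e dV hdV dW hdW → ℂ) h
      map_add' := fun y y' => funext fun h => by
        rw [Submodule.coe_add, Pi.add_apply]
        exact fourierCoeffDelta_add_of_continuous L e dV hdV dW hdW νN hβm hK hβK S (hPc _ y.2) (hPc _ y'.2) h
      map_smul' := fun c y => funext fun h => by
        rw [Submodule.coe_smul, RingHom.id_apply, Pi.smul_apply, smul_eq_mul]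
        exact fourierCoeffDelta_smul_fun L e dV hdV dW hdW νN β S c (y : HA L e dV hdV dW hdW → ℂ) h },
    fun _ _ _ => rfl⟩

end Summit.HodgeConjecture.HodgeConjecture.Cruxes.HLiu418.K2LiuFourierCoeffDeltaLinear

end
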